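import Summits.Ventures.HSemireg.WedgeBoxIndep

/-!
# Venture HSemireg — THEOREM K∘T for the box (3/8)

HONEST FRAMING. Part of the Lean index of the computation cell `pub-hsemireg` (seat p3; Sunday enclosure of the
FORMULA-N kernel assets of seats th-7 / th-6, ENCLOSURE-PLAN-p3.md).  Finite-dimensional exterior algebra over a field ONLY:
no variety, no cohomology theory, no semiregularity map is constructed here; nothing here says that HC / HC_CM / HC_AV holds;
no Literature fact is declared or used.  The geometric DICTIONARY (why these ranks are the `HT`-side box ranks of the cell's
STRUCTURE.md §1 / theory/FORMULA-N.md) lives in theory/FORMULA-N-th7.md PART B §A.3 / §N and is NOT asserted in Lean.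

THEOREM K∘T for the BOX of two point pairs (FORMULA-N PART A §2.3 / PART B §L; th-7 theory/th7/BoxRank.lean v4 sha256/16
88aeb4a1de514ae6, l.528–822), file 3 of 8 — generators `I n := Fin (4n)` in four blocks `A 0 = X`, `A 1 = Y` (factor 1), `C 0 = X′`,
`C 1 = Y′` (factor 2); the coefficient-matrix box `boxClass c := Σ_{α,β} c α β • E_{A α ∪ C β}` and the HONEST box `fac1 a * fac2 a′`;
ranks of `θ ↦ θ ∧ box` on `⋀^k` in every degree: `4C(2n,k) − 4C(n,k)` (0 < k < n), the degree-n PURITY DROP `4C(2n,n) − 6` on the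
decomposable locus, `4C(2n,k) − 4C(n,k−n)` (n < k < 2n), `1` in degrees 0 and 2n; one citable form `finrank_range_wedgeMap_fac_mul_all`
(file 8).  No permutation sign is ever evaluated.  th-7's statements and proofs, unchanged (namespace `HSemiregBox` ↦
`Summit.Ventures.HSemireg.WedgeBox`; this family's Fin-indexed `B K n s` is its own, kept apart from `Wedge.B` / `WedgePair.B` by namespace).
Part I/3 + II: the COUNT `card_Rel`, `finrank_range_wedgeMap_boxClass` (0 < k < n) and `_two` (= STRUCTURE C3: 6n² − 2n); graded commutativity; the honest box `fac1 * fac2 = boxClass (boxCoeff)`.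
-/

open Module Set Set.powersetCard

namespace Summit.Ventures.HSemireg.WedgeBox

variable (K : Type*) [Field K] {n : ℕ}

section Count

variable {k : ℕ}

/-- `|PureA k α| = C(n,k)`. -/
lemma card_PureA (α : Fin 2) : (PureA n k α).card = n.choose k := by
  rw [PureA, Finset.card_powersetCard, card_A]

/-- `|PureC k β| = C(n,k)`. -/
lemma card_PureC (β : Fin 2) : (PureC n k β).card = n.choose k := by
  rw [PureC, Finset.card_powersetCard, card_C]

/-- a set of positive cardinality is non-empty. -/
lemma nonempty_of_card (hk : 0 < k) {s : Finset (I n)} (hs : s.card = k) : s.Nonempty := by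
  rw [← Finset.card_pos, hs]; exact hk

/-- a nonempty set cannot lie in two disjoint sets. -/
lemma not_subset_of_disjoint {s t u : Finset (I n)} (hs : s.Nonempty) (htu : Disjoint t u) (ht : s ⊆ t)
    (hu : s ⊆ u) : False := by
  obtain ⟨i, hi⟩ := hs
  exact Finset.disjoint_left.mp htu (ht hi) (hu hi)

/-- pure factor-1 and pure factor-2 monomials are different (for `k > 0`). -/
lemma disjoint_PureA_PureC (hk : 0 < k) (α β : Fin 2) : Disjoint (PureA n k α) (PureC n k β) := by
  rw [Finset.disjoint_left]
  intro s hs hs'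
  rw [mem_PureA] at hs; rw [mem_PureC] at hs'
  exact not_subset_of_disjoint (nonempty_of_card hk hs.2) (disjoint_A_C n α β) hs.1 hs'.1

/-- COUNT of the mixed monomials of one pair: `|Mix k p| + 2·C(n,k) = C(2n,k)`. -/
lemma card_Mix (hk : 0 < k) (p : Fin 2 × Fin 2) :
    (Mix n k p).card + (n.choose k + n.choose k) = (n + n).choose k := by
  have hsub : PureA n k p.1 ∪ PureC n k p.2 ⊆ (P n p.1 p.2).powersetCard k := by
    apply Finset.union_subset
    · exact Finset.powersetCard_mono Finset.subset_union_left
    · exact Finset.powersetCard_mono Finset.subset_union_right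
  have h1 : (Mix n k p).card = ((P n p.1 p.2).powersetCard k).card - (PureA n k p.1 ∪ PureC n k p.2).card :=
    Finset.card_sdiff_of_subset hsub
  have h2 : (PureA n k p.1 ∪ PureC n k p.2).card = n.choose k + n.choose k := by
    rw [Finset.card_union_of_disjoint (disjoint_PureA_PureC hk _ _), card_PureA, card_PureC]
  have h3 := Finset.card_le_card hsub
  rw [Finset.card_powersetCard, card_P] at h1 h3
  rw [h2] at h3
  omega

/-- elements of a mixed set meet both of its blocks. -/
lemma exists_mem_A_of_mem_Mix {p : Fin 2 × Fin 2} {s : Finset (I n)} (hs : s ∈ Mix n k p) :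
    ∃ i ∈ s, i ∈ A n p.1 := by
  obtain ⟨hP, -, -, hC⟩ := mem_Mix.mp hs
  obtain ⟨i, hi, hiC⟩ := Finset.not_subset.mp hC
  refine ⟨i, hi, ?_⟩
  have := hP hi
  rw [P, Finset.mem_union] at this
  exact this.resolve_right hiC

/-- a mixed monomial meets its factor-2 block. -/
lemma exists_mem_C_of_mem_Mix {p : Fin 2 × Fin 2} {s : Finset (I n)} (hs : s ∈ Mix n k p) :
    ∃ i ∈ s, i ∈ C n p.2 := by
  obtain ⟨hP, -, hA, -⟩ := mem_Mix.mp hs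
  obtain ⟨i, hi, hiA⟩ := Finset.not_subset.mp hA
  refine ⟨i, hi, ?_⟩
  have := hP hi
  rw [P, Finset.mem_union] at this
  exact this.resolve_left hiA

/-- an index in `A α` and in `P α' β'` forces `α' = α`. -/
lemma eq_of_mem_A_of_mem_P {i : I n} {α α' β' : Fin 2} (h : i ∈ A n α) (h' : i ∈ P n α' β') : α' = α := by
  rw [P, Finset.mem_union] at h'
  rcases h' with h' | h'
  · by_contra hne
    exact Finset.disjoint_left.mp (disjoint_A_A n hne) h' h
  · exact (Finset.disjoint_left.mp (disjoint_A_C n α β') h h').elim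

/-- an index in `C β` and in `P α' β'` forces `β' = β`. -/
lemma eq_of_mem_C_of_mem_P {i : I n} {β α' β' : Fin 2} (h : i ∈ C n β) (h' : i ∈ P n α' β') : β' = β := by
  rw [P, Finset.mem_union] at h'
  rcases h' with h' | h'
  · exact (Finset.disjoint_left.mp (disjoint_A_C n α' β) h' h).elim
  · by_contra hne
    exact Finset.disjoint_left.mp (disjoint_C_C n hne) h' h

/-- the four mixed families are pairwise disjoint. -/
lemma Mix_pairwiseDisjoint : (↑(Finset.univ : Finset (Fin 2 × Fin 2)) : Set (Fin 2 × Fin 2)).PairwiseDisjoint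
    (Mix n k) := by
  intro p _ p' _ hne
  change Disjoint (Mix n k p) (Mix n k p')
  rw [Finset.disjoint_left]
  intro s hs hs'
  apply hne
  obtain ⟨i, hi, hiA⟩ := exists_mem_A_of_mem_Mix hs
  obtain ⟨j, hj, hjC⟩ := exists_mem_C_of_mem_Mix hs
  have hP' := (mem_Mix.mp hs').1
  have h1 : p'.1 = p.1 := eq_of_mem_A_of_mem_P hiA (hP' hi)
  have h2 : p'.2 = p.2 := eq_of_mem_C_of_mem_P hjC (hP' hj)
  exact (Prod.ext h1 h2).symm

/-- the pure factor-1 families are pairwise disjoint (`k > 0`). -/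
lemma PureA_pairwiseDisjoint (hk : 0 < k) :
    (↑(Finset.univ : Finset (Fin 2)) : Set (Fin 2)).PairwiseDisjoint (PureA n k) := by
  intro α _ α' _ hne
  change Disjoint (PureA n k α) (PureA n k α')
  rw [Finset.disjoint_left]
  intro s hs hs'
  rw [mem_PureA] at hs hs'
  exact not_subset_of_disjoint (nonempty_of_card hk hs.2) (disjoint_A_A n hne) hs.1 hs'.1

/-- the pure factor-2 families are pairwise disjoint (`k > 0`). -/
lemma PureC_pairwiseDisjoint (hk : 0 < k) :
    (↑(Finset.univ : Finset (Fin 2)) : Set (Fin 2)).PairwiseDisjoint (PureC n k) := by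
  intro β _ β' _ hne
  change Disjoint (PureC n k β) (PureC n k β')
  rw [Finset.disjoint_left]
  intro s hs hs'
  rw [mem_PureC] at hs hs'
  exact not_subset_of_disjoint (nonempty_of_card hk hs.2) (disjoint_C_C n hne) hs.1 hs'.1

/-- mixed and pure factor-1 monomials are different. -/
lemma disjoint_Mix_PureA (p : Fin 2 × Fin 2) (α : Fin 2) : Disjoint (Mix n k p) (PureA n k α) := by
  rw [Finset.disjoint_left]
  intro s hs hs'
  obtain ⟨j, hj, hjC⟩ := exists_mem_C_of_mem_Mix hs
  exact Finset.disjoint_left.mp (disjoint_A_C n α p.2) ((mem_PureA.mp hs').1 hj) hjC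

/-- mixed and pure factor-2 monomials are different. -/
lemma disjoint_Mix_PureC (p : Fin 2 × Fin 2) (β : Fin 2) : Disjoint (Mix n k p) (PureC n k β) := by
  rw [Finset.disjoint_left]
  intro s hs hs'
  obtain ⟨i, hi, hiA⟩ := exists_mem_A_of_mem_Mix hs
  exact Finset.disjoint_left.mp (disjoint_A_C n p.1 β) hiA ((mem_PureC.mp hs').1 hi)

/-- COUNT of all relevant monomials: `|Rel n k| + 4·C(n,k) = 4·C(2n,k)` (for `0 < k`). -/
theorem card_Rel (hk : 0 < k) : (Rel n k).card + 4 * n.choose k = 4 * (n + n).choose k := by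
  have hM : (Finset.univ.biUnion (Mix n k)).card = ∑ p : Fin 2 × Fin 2, (Mix n k p).card :=
    Finset.card_biUnion Mix_pairwiseDisjoint
  have hA : (Finset.univ.biUnion (PureA n k)).card = n.choose k + n.choose k := by
    rw [Finset.card_biUnion (PureA_pairwiseDisjoint hk)]
    simp [card_PureA, Finset.sum_const, two_mul]
  have hC : (Finset.univ.biUnion (PureC n k)).card = n.choose k + n.choose k := by
    rw [Finset.card_biUnion (PureC_pairwiseDisjoint hk)]
    simp [card_PureC, Finset.sum_const, two_mul]
  have hd1 : Disjoint (Finset.univ.biUnion (Mix n k)) (Finset.univ.biUnion (PureA n k)) := by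
    rw [Finset.disjoint_biUnion_left]; intro p _
    rw [Finset.disjoint_biUnion_right]; intro α _
    exact disjoint_Mix_PureA p α
  have hd2 : Disjoint (Finset.univ.biUnion (Mix n k) ∪ Finset.univ.biUnion (PureA n k))
      (Finset.univ.biUnion (PureC n k)) := by
    rw [Finset.disjoint_union_left]
    constructor
    · rw [Finset.disjoint_biUnion_left]; intro p _
      rw [Finset.disjoint_biUnion_right]; intro β _
      exact disjoint_Mix_PureC p β
    · rw [Finset.disjoint_biUnion_left]; intro α _
      rw [Finset.disjoint_biUnion_right]; intro β _
      exact disjoint_PureA_PureC hk α β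
  have hsum : ∑ p : Fin 2 × Fin 2, ((Mix n k p).card + (n.choose k + n.choose k)) =
      ∑ p : Fin 2 × Fin 2, (n + n).choose k := Finset.sum_congr rfl fun p _ => card_Mix hk p
  rw [Finset.sum_add_distrib, Finset.sum_const, Finset.sum_const, Finset.card_univ,
    Fintype.card_prod, Fintype.card_fin, smul_eq_mul, smul_eq_mul] at hsum
  rw [Rel, Finset.card_union_of_disjoint hd2, Finset.card_union_of_disjoint hd1, hM, hA, hC]
  omega

end Count

/-! ### Main theorem -/

/-- **THEOREM K ∘ T for the box of two point pairs (FORMULA-N Σ2 / STRUCTURE C3), wedge model, all `n`,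
middle degrees**: for `0 < k < n` and all four coefficients non-zero, the rank of `θ ↦ θ ∧ v` on `⋀^k(K^{4n})`,
`v = Σ c_{αβ} E_{A_α ∪ C_β}`, satisfies `rank + 4·C(n,k) = 4·C(2n,k)`, i.e. `rank = 4·C(2n,k) − 4·C(n,k) =
[t^k](2(1+t)^n − 1 − t^n)²` (`k = 2`, `n ≥ 3`: `6n² − 2n`). Kernel-checked linear algebra; no geometry. -/
theorem finrank_range_wedgeMap_boxClass {k : ℕ} (hk0 : 0 < k) (hkn : k < n) {c : Fin 2 → Fin 2 → K}
    (hc : ∀ α β, c α β ≠ 0) :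
    Module.finrank K (LinearMap.range (wedgeMap K n k (boxClass K n c))) + 4 * n.choose k =
      4 * (n + n).choose k := by
  rw [finrank_range_eq_card_Rel K c hkn hc, card_Rel hk0]

/-- the same in subtraction form. -/
theorem finrank_range_wedgeMap_boxClass' {k : ℕ} (hk0 : 0 < k) (hkn : k < n) {c : Fin 2 → Fin 2 → K}
    (hc : ∀ α β, c α β ≠ 0) :
    Module.finrank K (LinearMap.range (wedgeMap K n k (boxClass K n c))) =
      4 * (n + n).choose k - 4 * n.choose k := by
  have := finrank_range_wedgeMap_boxClass K hk0 hkn hc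
  omega

/-- the census column C3 (`HT²`-rank of `⌟ch(I_p ⊠ I_q)` on `X × X′`, `dim X = n ≥ 3`): `6n² − 2n`
(stated additively: `rank + 2n = 6n²`). -/
theorem finrank_range_wedgeMap_boxClass_two (hn : 3 ≤ n) {c : Fin 2 → Fin 2 → K} (hc : ∀ α β, c α β ≠ 0) :
    Module.finrank K (LinearMap.range (wedgeMap K n 2 (boxClass K n c))) + 2 * n = 6 * n ^ 2 := by
  have h := finrank_range_wedgeMap_boxClass K (n := n) (k := 2) (by omega) (by omega) hc
  rw [Nat.choose_two_right, Nat.choose_two_right] at h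
  have e1 : 2 * (n * (n - 1) / 2) = n * (n - 1) := Nat.two_mul_div_two_of_even (Nat.even_mul_pred_self n)
  have e2 : 2 * ((n + n) * (n + n - 1) / 2) = (n + n) * (n + n - 1) :=
    Nat.two_mul_div_two_of_even (Nat.even_mul_pred_self (n + n))
  have key : Module.finrank K (LinearMap.range (wedgeMap K n 2 (boxClass K n c))) + 2 * (n * (n - 1)) =
      2 * ((n + n) * (n + n - 1)) := by omega
  obtain ⟨m, rfl⟩ : ∃ m, n = m + 1 := ⟨n - 1, by omega⟩
  have h5 : m + 1 - 1 = m := by omega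
  have h6 : m + 1 + (m + 1) - 1 = 2 * m + 1 := by omega
  rw [h5, h6] at key
  ring_nf at key ⊢
  omega

/-! ## Part II (th-7 g2, 2026-08-22 afternoon): graded commutativity, the HONEST box `f₁ ∧ f₂`,
and the degree-`n` purity drop `4·C(2n,n) − 6`.

Everything below stays «sign-free» in the sense that no permutation sign is ever EVALUATED: the only
sign facts used are `ι x ∧ ι y = −ι y ∧ ι x` (hence `E_t ∧ E_s = (−1)^{|s||t|} E_s ∧ E_t`) and that the
structure constants `sgn s t` are units when `s ∩ t = ∅`. -/

section GradedComm

/-- `ι x` anticommutes past a product of `ι`'s, picking up `(−1)^{length}`. -/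
lemma ι_mul_ιprod (x : N K n) (l : List (N K n)) :
    ExteriorAlgebra.ι K x * (l.map (ExteriorAlgebra.ι K)).prod =
      ((-1 : K) ^ l.length) • ((l.map (ExteriorAlgebra.ι K)).prod * ExteriorAlgebra.ι K x) := by
  induction l with
  | nil => simp
  | cons y l ih =>
    have hxy : ExteriorAlgebra.ι K x * ExteriorAlgebra.ι K y =
        -(ExteriorAlgebra.ι K y * ExteriorAlgebra.ι K x) :=
      eq_neg_of_add_eq_zero_left (ExteriorAlgebra.ι_add_mul_swap x y)
    rw [List.map_cons, List.prod_cons, List.length_cons, ← mul_assoc, hxy, neg_mul, mul_assoc, ih,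
      mul_smul_comm, pow_succ, mul_neg_one, neg_smul, mul_assoc]

/-- graded commutativity for products of `ι`'s. -/
lemma ιprod_mul_ιprod (l₁ l₂ : List (N K n)) :
    (l₁.map (ExteriorAlgebra.ι K)).prod * (l₂.map (ExteriorAlgebra.ι K)).prod =
      ((-1 : K) ^ (l₁.length * l₂.length)) •
        ((l₂.map (ExteriorAlgebra.ι K)).prod * (l₁.map (ExteriorAlgebra.ι K)).prod) := by
  induction l₁ with
  | nil => simp
  | cons x l₁ ih =>
    rw [List.map_cons, List.prod_cons, List.length_cons, mul_assoc, ih, mul_smul_comm, ← mul_assoc,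
      ι_mul_ιprod, smul_mul_assoc, smul_smul, add_mul, one_mul, pow_add, mul_assoc]

/-- a basis monomial is a product of `ι`'s of basis vectors (in increasing order). -/
lemma B_eq_ιprod {k : ℕ} (s : powersetCard (I n) k) :
    B K n s = ((List.ofFn ((b K n) ∘ (ofFinEmbEquiv.symm s))).map (ExteriorAlgebra.ι K)).prod := by
  rw [B_apply_pc, ExteriorAlgebra.basis_apply_powersetCard, List.map_ofFn]
  rfl

/-- **graded commutativity of monomials**: `E_t ∧ E_s = (−1)^{|t||s|} E_s ∧ E_t`. -/
lemma B_mul_B_comm {k m : ℕ} (s : powersetCard (I n) k) (t : powersetCard (I n) m) :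
    B K n t * B K n s = ((-1 : K) ^ (m * k)) • (B K n s * B K n t) := by
  rw [B_eq_ιprod K s, B_eq_ιprod K t, ιprod_mul_ιprod, List.length_ofFn, List.length_ofFn]

end GradedComm

/-! ### The honest box: `f₁ = a₀E_X + a₁E_Y`, `f₂ = a′₀E_{X′} + a′₁E_{Y′}`, `v = f₁ ∧ f₂`. -/

section HonestBox

variable (n)

/-- the factor-1 blocks as elements of `powersetCard`. -/
def Apc (α : Fin 2) : powersetCard (I n) n := ⟨A n α, by rw [mem_iff, card_A]⟩

/-- the factor-2 blocks as elements of `powersetCard`. -/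
def Cpc (β : Fin 2) : powersetCard (I n) n := ⟨C n β, by rw [mem_iff, card_C]⟩

/-- coercion of `Apc α` is `A α`. -/
@[simp] lemma coe_Apc (α : Fin 2) : ((Apc n α : powersetCard (I n) n) : Finset (I n)) = A n α := rfl

/-- coercion of `Cpc β` is `C β`. -/
@[simp] lemma coe_Cpc (β : Fin 2) : ((Cpc n β : powersetCard (I n) n) : Finset (I n)) = C n β := rfl

/-- the factor-1 class `a₀·E_X + a₁·E_Y` (model of `a₀·1 + a₁·pt` on `X`, pulled back). -/
noncomputable def fac1 (a : Fin 2 → K) : HT K n := ∑ α, a α • B K n (Apc n α : powersetCard (I n) n)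

/-- the factor-2 class `a′₀·E_{X′} + a′₁·E_{Y′}`. -/
noncomputable def fac2 (a' : Fin 2 → K) : HT K n := ∑ β, a' β • B K n (Cpc n β : powersetCard (I n) n)

variable {n}

/-- the coefficient matrix of the honest box: rank one up to the unit structure constants. -/
noncomputable def boxCoeff (a a' : Fin 2 → K) : Fin 2 → Fin 2 → K :=
  fun α β => a α * a' β * sgn K (Apc n α) (Cpc n β)

/-- `f₁ ∧ f₂` is a box class. -/
lemma fac1_mul_fac2 (a a' : Fin 2 → K) :
    fac1 K n a * fac2 K n a' = boxClass K n (boxCoeff K (n := n) a a') := by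
  rw [fac1, fac2, boxClass, Finset.sum_mul]
  refine Finset.sum_congr rfl fun α _ => ?_
  rw [Finset.mul_sum]
  refine Finset.sum_congr rfl fun β _ => ?_
  rw [smul_mul_assoc, mul_smul_comm, B_mul_B, smul_smul, smul_smul]
  rfl

/-- the honest box has all four coefficients non-zero when the factor coefficients are. -/
lemma boxCoeff_ne_zero {a a' : Fin 2 → K} (ha : ∀ α, a α ≠ 0) (ha' : ∀ β, a' β ≠ 0) (α β : Fin 2) :
    boxCoeff K (n := n) a a' α β ≠ 0 := by
  unfold boxCoeff
  refine mul_ne_zero (mul_ne_zero (ha α) (ha' β)) ((sgn_ne_zero_iff K).mpr ?_)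
  exact disjoint_A_C n α β

/-- **the box law for the honest product class** (`0 < k < n`): `rank + 4·C(n,k) = 4·C(2n,k)`. -/
theorem finrank_range_wedgeMap_fac_mul {k : ℕ} (hk0 : 0 < k) (hkn : k < n) {a a' : Fin 2 → K}
    (ha : ∀ α, a α ≠ 0) (ha' : ∀ β, a' β ≠ 0) :
    Module.finrank K (LinearMap.range (wedgeMap K n k (fac1 K n a * fac2 K n a'))) + 4 * n.choose k =
      4 * (n + n).choose k := by
  rw [fac1_mul_fac2]
  exact finrank_range_wedgeMap_boxClass K hk0 hkn (boxCoeff_ne_zero K ha ha')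

/-- `C3` for the honest product class: `rank + 2n = 6n²` (`n ≥ 3`). -/
theorem finrank_range_wedgeMap_fac_mul_two (hn : 3 ≤ n) {a a' : Fin 2 → K}
    (ha : ∀ α, a α ≠ 0) (ha' : ∀ β, a' β ≠ 0) :
    Module.finrank K (LinearMap.range (wedgeMap K n 2 (fac1 K n a * fac2 K n a'))) + 2 * n = 6 * n ^ 2 := by
  rw [fac1_mul_fac2]
  exact finrank_range_wedgeMap_boxClass_two K hn (boxCoeff_ne_zero K ha ha')

end HonestBox

/-! ### Degree `n` (the purity case): the four whole blocks pair up, `rank = 4·C(2n,n) − 6`. -/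

end Summit.Ventures.HSemireg.WedgeBox
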